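import Literature.NumberTheory.PAdicHodge.AinfWeierstrassRamifiedCellsWitness
import HarnessLib

/-!
# The K★ cell models on the (G)-ORDINARY cells in the `𝒪_F`-currency: unit discriminant and ORDINARY reduction (`A_p ≠ 0`),
# UNCONDITIONALLY from the cells' unit (proofs only)

Topic `Literature/NumberTheory/PAdicHodge`; namespace `Literature.NumberTheory.PAdicHodge`. THEOREMS ONLY (no definition, no named fact, no
instance, no `sorry`). ORDINARY twin of `AinfWeierstrassRamifiedCellsWitness` / `EisensteinRootShortModel` §4 (those give `A_p = 0` and exact height
`2` on the three potentially SUPERSINGULAR cells `(5; r₄ > 0)`, `(7; r₆ > 0)`). For the model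
`W_D = ⟨0, 0, 0, a·ϱ^{r₄}, b·ϱ^{r₆}⟩` over `𝒪_D = ℤ_p[ϱ]`, `ϱ^e = p`, `a, b ∈ ℤ_p`, on the three (G)-ORDINARY starred cells of crux K★ —
`(5; III*)`: `(e; r₄, r₆; t₄, t₆) = (4; 0, 2; 0, 1)`, `(7; IV*)`: `(3; 1, 0; 1, 0)`, `(7; II*)`: `(6; 4, 0; 2, 0)` — i.e. `(p; r₄, r₆) ∈ {(5; 0, >0),
(7; >0, 0)}`, the reduction along ANY `γ : 𝒪_D → k` (`k` a field of characteristic `p`, `γ(ϱ) = 0`) is `y² = x³ + ā x` (`A_5 = 32 ā`) resp.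
`y² = x³ + b̄` (`A_7 = 192 b̄`), ORDINARY as soon as `a` (resp. `b`) is a `p`-adic unit — which the cells' unit `64a³p^{t₄} + 432b²p^{t₆} ∈ ℤ_pˣ`
forces (`t₄ = 0 < t₆` at `5`, `t₄ > 0 = t₆` at `7`):

* §1 `hasseCoeff_map_model_five_ne_zero` / `hasseCoeff_map_model_seven_ne_zero` — `A_p(W_D ⊗_γ k) ≠ 0` along any `γ : 𝒪_D → k`;
* §2 `isUnit_of_isUnit_cells_ord` — `a ∈ ℤ_5ˣ` / `b ∈ ℤ_7ˣ` from the cells' unit; ★ `AinfTop.hasseCoeff_red_map_model_ne_zero` — for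
  `β : 𝒪_D →+* LTCoeff F` and the model `W := W_D ⊗_β 𝒪_F`: **`A_p(W mod 𝔪_F) ≠ 0`** (`γ := redCoeff F ∘ β`), the ORDINARY hypothesis in the
  currency of the line's socket (`hA` of `…TransportedReciprocity*` negated; the input of `KernelReductionOrdinaryTorsionProofs` /
  `OrdinaryReductionKernelTorsionProofs` §5 — `p`-divisibility of `E₁(ℂ_F)` and rank one of `T_pŴ` — through `natDegree_ΨSq_prime_eq`), and
  `AinfTop.hasseCoeff_red_map_model_ne_zero_of_isUnit_cells` (the same from the unit). Unit discriminant is `isUnit_Δ_map_model` of the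
  supersingular file verbatim (it does not use supersingularity).

BSD route EdixhovenFibreFiveSeven, crux K★ `stmt-BirchSwinnertonDyer-22226`, line `kato_lever`, stub `stub_localFormulaOrdinaryCells` (memo
`Summits/…/Cruxes/StarredOptimalManinUnitFiveSeven/Lines/kato-lever-seam-rec-at-cells.md` §16–§17: «cells … numerology verbatim with
`(e; r₄, r₆) = (4; 0, 2), (3; 1, 0), (6; 4, 0)` and `hA₀` replaced»). Infrastructure only; BSD / K★ are not proved by any of this.

## References
* [SilvermanAEC2009] J. H. Silverman, *AEC* (2009), V.4.1 (Deuring's criterion), Ex. V.4.4–4.5, VII.5.5.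
* [Serre1972] J.-P. Serre, Invent. Math. 15 (1972), §1.11 (height one).
-/

noncomputable section

open scoped Classical
open Field ValuativeRel Polynomial

namespace Literature.NumberTheory.PAdicHodge

open Literature.NumberTheory.GaloisRepresentations
open Literature.NumberTheory.GaloisRepresentations.IsNonarchimedeanLocalField
open Literature.NumberTheory.GaloisRepresentations.LubinTate
open Literature.NumberTheory.EllipticCurves

/-! ## §1 The models `⟨0, 0, 0, a·ϱ^{r₄}, b·ϱ^{r₆}⟩` reduce to ORDINARY curves on the cells `(5; r₄ = 0)`, `(7; r₆ = 0)` -/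

section Model

variable {e : ℕ}

/-- **`A_5 ≠ 0` for the model when `r₄ = 0` and `a ∈ ℤ_5ˣ`** (reduction `y² = x³ + ā x`, `j̃ = 1728`, ORDINARY at `5 ≡ 1 (4)`: `A_5 = 32 ā`), read
along any `γ : 𝒪_D → k` into a field of characteristic `5`. [cite: SilvermanAEC2009, V.4.1 and Ex. V.4.5] -/
theorem hasseCoeff_map_model_five_ne_zero [Fact (5 : ℕ).Prime] {f : ℤ_[5][X]}
    (hroot : AdjoinRoot.root f ^ e = AdjoinRoot.of f (5 : ℕ)) (a b : ℤ_[5]) {r₄ : ℕ} (hr₄ : r₄ = 0) (r₆ : ℕ) (ha : IsUnit a)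
    {k : Type*} [Field k] [CharP k 5] (γ : AdjoinRoot f →+* k) :
    ((⟨0, 0, 0, AdjoinRoot.of f a * AdjoinRoot.root f ^ r₄, AdjoinRoot.of f b * AdjoinRoot.root f ^ r₆⟩ :
        WeierstrassCurve (AdjoinRoot f)).map γ).hasseCoeff 5 ≠ 0 := by
  rw [map_model_eq_map_castHom hroot a b r₄ r₆ γ, if_pos hr₄, WeierstrassCurve.map_hasseCoeff, hasseCoeff_five_short,
    map_ne_zero_iff _ (RingHom.injective _)]
  have h32 : (32 : ZMod 5) ≠ 0 := by
    rw [show (32 : ZMod 5) = ((32 : ℤ) : ZMod 5) by push_cast; rfl, Ne, ZMod.intCast_zmod_eq_zero_iff_dvd]; norm_num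
  exact mul_ne_zero h32 ((ha.map PadicInt.toZMod).ne_zero)

/-- **`A_7 ≠ 0` for the model when `r₆ = 0` and `b ∈ ℤ_7ˣ`** (reduction `y² = x³ + b̄`, `j̃ = 0`, ORDINARY at `7 ≡ 1 (3)`: `A_7 = 192 b̄`), read along
any `γ : 𝒪_D → k` into a field of characteristic `7`. [cite: SilvermanAEC2009, V.4.1 and Ex. V.4.4] -/
theorem hasseCoeff_map_model_seven_ne_zero [Fact (7 : ℕ).Prime] {f : ℤ_[7][X]}
    (hroot : AdjoinRoot.root f ^ e = AdjoinRoot.of f (7 : ℕ)) (a b : ℤ_[7]) (r₄ : ℕ) {r₆ : ℕ} (hr₆ : r₆ = 0) (hb : IsUnit b)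
    {k : Type*} [Field k] [CharP k 7] (γ : AdjoinRoot f →+* k) :
    ((⟨0, 0, 0, AdjoinRoot.of f a * AdjoinRoot.root f ^ r₄, AdjoinRoot.of f b * AdjoinRoot.root f ^ r₆⟩ :
        WeierstrassCurve (AdjoinRoot f)).map γ).hasseCoeff 7 ≠ 0 := by
  rw [map_model_eq_map_castHom hroot a b r₄ r₆ γ, if_pos hr₆, WeierstrassCurve.map_hasseCoeff, hasseCoeff_seven_short,
    map_ne_zero_iff _ (RingHom.injective _)]
  have h192 : (192 : ZMod 7) ≠ 0 := by
    rw [show (192 : ZMod 7) = ((192 : ℤ) : ZMod 7) by push_cast; rfl, Ne, ZMod.intCast_zmod_eq_zero_iff_dvd]; norm_num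
  exact mul_ne_zero h192 ((hb.map PadicInt.toZMod).ne_zero)

/-- **`a ∈ ℤ_5ˣ` at `5`, `b ∈ ℤ_7ˣ` at `7` from the cells' unit `64a³p^{t₄} + 432b²p^{t₆} ∈ ℤ_pˣ`** on the ORDINARY cells (`t₄ = 0 < t₆` at `5`:
the unit is `64a³ + 5·(…)`; `t₄ > 0 = t₆` at `7`: `432b² + 7·(…)`; `ℤ_p` is local). [cite: SilvermanAEC2009, VII.5.5] -/
theorem isUnit_of_isUnit_cells_ord {p : ℕ} [Fact p.Prime] (a b : ℤ_[p]) (hp57 : p = 5 ∨ p = 7) {t₄ t₆ : ℕ}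
    (ht : (p = 5 → t₄ = 0 ∧ 0 < t₆) ∧ (p = 7 → 0 < t₄ ∧ t₆ = 0))
    (hu : IsUnit (64 * a ^ 3 * (p : ℤ_[p]) ^ t₄ + 432 * b ^ 2 * (p : ℤ_[p]) ^ t₆)) :
    (p = 5 → IsUnit a) ∧ (p = 7 → IsUnit b) := by
  -- a sum `x + p·y` in the local ring `ℤ_p` is a unit iff `x` is
  have key : ∀ (x y : ℤ_[p]), IsUnit (x + (p : ℤ_[p]) * y) → IsUnit x := fun x y h => by
    by_contra hx
    have hxm : x ∈ IsLocalRing.maximalIdeal ℤ_[p] := (IsLocalRing.mem_maximalIdeal _).2 hx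
    have hym : (p : ℤ_[p]) * y ∈ IsLocalRing.maximalIdeal ℤ_[p] := by
      rw [PadicInt.maximalIdeal_eq_span_p]; exact Ideal.mul_mem_right _ _ (Ideal.mem_span_singleton_self _)
    exact (IsLocalRing.mem_maximalIdeal _).1 (Ideal.add_mem _ hxm hym) h
  -- `c · n^k` a unit with `k > 0` forces `n` to be a unit
  have hfac : ∀ (n c : ℤ_[p]) (k : ℕ), IsUnit (c * n ^ k) → 0 < k → IsUnit n := fun n c k h hk =>
    isUnit_of_dvd_unit (dvd_mul_of_dvd_right (dvd_pow_self _ hk.ne') _) h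
  rcases hp57 with rfl | rfl
  · obtain ⟨h₄, h₆⟩ := ht.1 rfl
    refine ⟨fun _ => ?_, fun h => by norm_num at h⟩
    rw [h₄, pow_zero, mul_one] at hu
    obtain ⟨t, rfl⟩ : ∃ t, t₆ = t + 1 := ⟨t₆ - 1, by omega⟩
    have hu' : IsUnit (64 * a ^ 3 + ((5 : ℕ) : ℤ_[5]) * (432 * b ^ 2 * ((5 : ℕ) : ℤ_[5]) ^ t)) := by
      convert hu using 1; ring
    exact hfac a 64 3 (key _ _ hu') three_pos
  · obtain ⟨h₄, h₆⟩ := ht.2 rfl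
    refine ⟨fun h => by norm_num at h, fun _ => ?_⟩
    rw [h₆, pow_zero, mul_one] at hu
    obtain ⟨t, rfl⟩ : ∃ t, t₄ = t + 1 := ⟨t₄ - 1, by omega⟩
    have hu' : IsUnit (432 * b ^ 2 + ((7 : ℕ) : ℤ_[7]) * (64 * a ^ 3 * ((7 : ℕ) : ℤ_[7]) ^ t)) := by
      convert hu using 1; ring
    exact hfac b 432 2 (key _ _ hu') two_pos

end Model

/-! ## §2 The `𝒪_F`-model `W_D ⊗_β 𝒪_F` has ORDINARY reduction -/

namespace AinfTop

variable {F : Type} [Field F] [ValuativeRel F] [TopologicalSpace F] [IsNonarchimedeanLocalField F] [CharZero F]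
  {p : ℕ} [Fact p.Prime] {hp : valuation F p < 1} {D : EisensteinRoot F p hp} [CharP 𝓀[F] p] {e : ℕ}
  (hD : D.poly = X ^ e - C (p : ℤ_[p])) (β : D.Coeff →+* LTCoeff F) (a b : ℤ_[p]) {r₄ r₆ t₄ t₆ : ℕ}

include hD

/-- ★ **ORDINARY reduction of `W_D ⊗_β 𝒪_F`** for the model at `p ∈ {5, 7}` on the cells `(5; r₄ = 0)` with `a ∈ ℤ_5ˣ`, `(7; r₆ = 0)` with
`b ∈ ℤ_7ˣ`, read along `redCoeff F ∘ β : 𝒪_D → 𝓀_F`: `A_p(W mod 𝔪_F) ≠ 0`. [cite: SilvermanAEC2009, V.4.1 and Ex. V.4.4–4.5] -/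
theorem hasseCoeff_red_map_model_ne_zero (hp57 : p = 5 ∨ p = 7) (hr₄ : p = 5 → r₄ = 0) (hr₆ : p = 7 → r₆ = 0)
    (ha : p = 5 → IsUnit a) (hb : p = 7 → IsUnit b) :
    (((⟨0, 0, 0, AdjoinRoot.of D.poly a * AdjoinRoot.root D.poly ^ r₄, AdjoinRoot.of D.poly b * AdjoinRoot.root D.poly ^ r₆⟩ :
      WeierstrassCurve D.Coeff).map β).map (redCoeff F)).hasseCoeff p ≠ 0 := by
  rw [WeierstrassCurve.map_map]
  have hroot := D.root_pow_eq_of_poly_eq hD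
  rcases hp57 with rfl | rfl
  · exact hasseCoeff_map_model_five_ne_zero hroot a b (hr₄ rfl) r₆ (ha rfl) _
  · exact hasseCoeff_map_model_seven_ne_zero hroot a b r₄ (hr₆ rfl) (hb rfl) _

/-- ★ **ORDINARY reduction of `W_D ⊗_β 𝒪_F` from the cells' unit**: on the (G)-ordinary cells (`t₄ = 0 < t₆`, `r₄ = 0` at `5`; `t₄ > 0 = t₆`,
`r₆ = 0` at `7`; `64a³p^{t₄} + 432b²p^{t₆} ∈ ℤ_pˣ`), `A_p(W mod 𝔪_F) ≠ 0`. Together with `isUnit_Δ_map_model` (unit discriminant, any cell) this is the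
model-side input `IsUnit Δ ∧ A_p ≠ 0` of the height-one theory (`OrdinaryReductionKernelTorsionProofs` §5 via `natDegree_ΨSq_prime_eq`).
[cite: SilvermanAEC2009, V.4.1 and VII.5.5] [cite: Serre1972, §1.11] -/
theorem hasseCoeff_red_map_model_ne_zero_of_isUnit_cells (hp57 : p = 5 ∨ p = 7)
    (hr : (p = 5 → r₄ = 0) ∧ (p = 7 → r₆ = 0)) (ht : (p = 5 → t₄ = 0 ∧ 0 < t₆) ∧ (p = 7 → 0 < t₄ ∧ t₆ = 0))
    (hu : IsUnit (64 * a ^ 3 * (p : ℤ_[p]) ^ t₄ + 432 * b ^ 2 * (p : ℤ_[p]) ^ t₆)) :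
    (((⟨0, 0, 0, AdjoinRoot.of D.poly a * AdjoinRoot.root D.poly ^ r₄, AdjoinRoot.of D.poly b * AdjoinRoot.root D.poly ^ r₆⟩ :
      WeierstrassCurve D.Coeff).map β).map (redCoeff F)).hasseCoeff p ≠ 0 :=
  have hab := isUnit_of_isUnit_cells_ord a b hp57 ht hu
  hasseCoeff_red_map_model_ne_zero hD β a b hp57 hr.1 hr.2 hab.1 hab.2


/-! ## §3 Height one in the currency of `FormalGroupDivisionHeightOne`: `[Xᵖ][p]_W ∈ 𝒪_Fˣ` from `A_p(W mod 𝔪_F) ≠ 0` -/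

omit hD [CharZero F] in
/-- ★ **`[Xᵖ][p]_W` is a UNIT of `𝒪_F` when the reduction of `W/𝒪_F` is ordinary** (`A_p(W mod 𝔪_F) ≠ 0`, `p` odd = residue characteristic):
`[p]_W(X) ≡ A_p(W)·Xᵖ (mod p, X^{p+1})` (AEC IV.4.4 / Katz–Mazur 12.4.2, the tree's universal `coeff_prime_formalMul_sub_hasseCoeff_mem_span`), so the
residue of `[Xᵖ][p]_W` is `A_p(W mod 𝔪_F) ≠ 0` and `𝒪_F` is local. This is the hypothesis `h1` of
`FormalGroupDivisionHeightOne.exists_evalPt₁_formalMul_prime_eq` (`[p]_W : Ŵ(𝔪_ℂ) → Ŵ(𝔪_ℂ)` onto) in the Hasse-invariant currency of the cells.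
[cite: SilvermanAEC2009, IV.4.4 and V.4.1] [cite: Serre1972, §1.11] -/
theorem isUnit_coeff_prime_formalMul_of_hasseCoeff_red_ne_zero (W : WeierstrassCurve (LTCoeff F)) (hp2 : p ≠ 2)
    (hA : (W.map (redCoeff F)).hasseCoeff p ≠ 0) : IsUnit (PowerSeries.coeff p (W.formalMul p)) := by
  -- in the residue field: `[Xᵖ][p] = A_p`
  have hred : redCoeff F (PowerSeries.coeff p (W.formalMul p)) = (W.map (redCoeff F)).hasseCoeff p := by
    have h := (W.map (redCoeff F)).coeff_prime_formalMul_sub_hasseCoeff_mem_span p hp2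
    rw [CharP.cast_eq_zero 𝓀[F] p, Ideal.span_singleton_zero, Ideal.mem_bot, sub_eq_zero, ← WeierstrassCurve.map_formalMul,
      PowerSeries.coeff_map] at h
    exact h
  -- a nonzero residue in the local ring `𝒪_F` means a unit
  set y : 𝒪[F] := (LTCoeff.of F).symm (PowerSeries.coeff p (W.formalMul p)) with hy
  have hres : IsLocalRing.residue 𝒪[F] y ≠ 0 := by
    have : redCoeff F (PowerSeries.coeff p (W.formalMul p)) = IsLocalRing.residue 𝒪[F] y := rfl
    rw [← this, hred]; exact hA
  have hyu : IsUnit y := by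
    by_contra h
    exact hres ((IsLocalRing.residue_eq_zero_iff _).2 ((IsLocalRing.mem_maximalIdeal _).2 h))
  have : PowerSeries.coeff p (W.formalMul p) = LTCoeff.of F y := by rw [hy, RingEquiv.apply_symm_apply]
  rw [this]
  exact hyu.map _

omit hD [CharZero F] in
/-- The same read in `𝒪_{ℂ_F}`: `[Xᵖ][p]_W` maps to a unit of `CBall F` — VERBATIM the hypothesis `h1` of
`FormalGroupDivisionHeightOne.exists_evalPt₁_formalMul_prime_eq` (with `A = LTCoeff F`). [cite: SilvermanAEC2009, IV.4.4 and V.4.1] -/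
theorem isUnit_algebraMap_coeff_prime_formalMul_of_hasseCoeff_red_ne_zero (W : WeierstrassCurve (LTCoeff F)) (hp2 : p ≠ 2)
    (hA : (W.map (redCoeff F)).hasseCoeff p ≠ 0) :
    IsUnit (algebraMap (LTCoeff F) (CBall F) (PowerSeries.coeff p (W.formalMul p))) :=
  (isUnit_coeff_prime_formalMul_of_hasseCoeff_red_ne_zero W hp2 hA).map _

/-- ★ **Height one of the cell models `W_D ⊗_β 𝒪_F` on the (G)-ordinary cells, in the currency of `FormalGroupDivisionHeightOne`**:
`[Xᵖ][p]_{W_D ⊗_β 𝒪_F}` maps to a unit of `𝒪_{ℂ_F}` (`(5; r₄ = 0)`, `(7; r₆ = 0)`, cells' unit `64a³p^{t₄} + 432b²p^{t₆}` with `t₄ = 0 < t₆` / `t₄ > 0 = t₆`),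
so `[p] : Ŵ_D(𝔪_ℂ) → Ŵ_D(𝔪_ℂ)` is onto (`exists_evalPt₁_formalMul_prime_eq`). [cite: SilvermanAEC2009, IV.4.4, V.4.1 and VII.5.5] -/
theorem isUnit_algebraMap_coeff_prime_formalMul_model_of_isUnit_cells (hp57 : p = 5 ∨ p = 7)
    (hr : (p = 5 → r₄ = 0) ∧ (p = 7 → r₆ = 0)) (ht : (p = 5 → t₄ = 0 ∧ 0 < t₆) ∧ (p = 7 → 0 < t₄ ∧ t₆ = 0))
    (hu : IsUnit (64 * a ^ 3 * (p : ℤ_[p]) ^ t₄ + 432 * b ^ 2 * (p : ℤ_[p]) ^ t₆)) :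
    IsUnit (algebraMap (LTCoeff F) (CBall F) (PowerSeries.coeff p
      (((⟨0, 0, 0, AdjoinRoot.of D.poly a * AdjoinRoot.root D.poly ^ r₄, AdjoinRoot.of D.poly b * AdjoinRoot.root D.poly ^ r₆⟩ :
        WeierstrassCurve D.Coeff).map β).formalMul p))) :=
  have hp2 : p ≠ 2 := by rcases hp57 with rfl | rfl <;> norm_num
  isUnit_algebraMap_coeff_prime_formalMul_of_hasseCoeff_red_ne_zero _ hp2
    (hasseCoeff_red_map_model_ne_zero_of_isUnit_cells hD β a b hp57 hr ht hu)

end AinfTop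

end Literature.NumberTheory.PAdicHodge

end
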